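import Summits.QuantumFields.YangMills.Theorems.BalabanUVNodesN14VarianceSocket

/-!
# BalabanUVNodes ∕ node N14 = NE1′ — THE ANNEALED BORN TERMS OF THE REVERSE MARTINGALE: monotone `k ↦ ∫ log μ[Φ|𝒢 k]`, total
# increase between `0` and the initial energy ∕ (2a²) — K-uniform, estimate-free (LENS control, card 2 (iii))

Cell `pub-ymgap`, HUMAN RULING D-0062 (Track A at full width), seat `pub-ymgap-dag-n14-c` (R134 ACCELERATION, strategy s1), generation 3;
route `Summits/QuantumFields/YangMills/Theses/BalabanUVNodes.lean` (cluster K3′ `SpineGivenEndpointR12`, `--supports … --as helper`); venue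
ruling R424 (`YangMills/Theorems`, namespace `YMDAG.N14.BornTermAnnealed`).  ADDITIVE — imports this seat's `…N14VarianceSocket.lean`
(p468368 ✓: `condExp_log_gap_le`, `integral_sq_condExp_sub_condExp_of_le`, `energy_identity_antitone`) ONLY; theorems only; modifies nothing.

WHAT THIS IS.  Card 2 of the control lens (memo `LENS-control.md` bdbc715bd5c6066f) reads the convention-(α) dressed weight at step `k` as
the reverse martingale `N k = μ[Φ | 𝒢 k]` of the bounded positive variable `Φ = e^{tF₀} ∈ [a, b]` (`a = e^{−l₀B}`) along the
history-extended chain's antitone σ-algebras, and the BORN TERM of step `k` as the pathwise Jensen gap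
`log N (k+1) − μ[log N k | 𝒢 (k+1)]`.  `…N14VarianceSocket` §3 bounded that gap by the conditional variance ∕ (2a²); this file anneals it:
* §1 `ae_mem_Icc_condExp` (values in `[a, b]` ⇒ conditional expectation in `[a, b]` a.e., Mathlib `Convex.condExp_mem`) and
  `condExp_log_gap_le_ae` (the log Jensen gap bound under an a.e. hypothesis, by clamping) — plumbing.
* §2 `integral_log_condExp_le_succ` — **MONOTONICITY**: `∫ log N k ≤ ∫ log N (k+1)` (conditional Jensen for the concave `log`); and
  `integral_log_condExp_succ_sub_le` — **ONE STEP**: `∫ log N (k+1) − ∫ log N k ≤ (∫ (N k)² − ∫ (N (k+1))²) ∕ (2a²)` (the annealed born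
  term of step `k` is at most the step's energy ∕ (2a²); `…VarianceSocket.condExp_log_gap_le` + tower + Pythagoras).
* §3 **`integral_log_condExp_sub_mem`** — TELESCOPED, K-UNIFORM: `0 ≤ ∫ log N K − ∫ log N 0 ≤ (∫ (N 0)² − ∫ (N K)²) ∕ (2a²) ≤ ∫ (N 0)² ∕ (2a²)`:
  the annealed TOTAL of the born terms over any number of steps is nonnegative and bounded by the initial energy ∕ (2a²) — no rate, no
  locality, no Bałaban estimate (`energy_identity_antitone`).

WHAT THIS IS NOT.  [folklore] conditional Jensen bookkeeping; whether NODE O's represented tower exposes the history as a state variable with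
positive transition pieces (so that the dressed weights ARE these conditional expectations — card 2's kill-test) is OBJECT-bound and NOT
asserted; an annealed `L²`∕`log` budget is NOT what `ClassBudgetStrict`∕`DressedStabilityStrict` (sup-norm) or `OldInfluenceBudget` (a rate
per class) consume — this is the SUM-RULE ∕ ENERGY TEST a producer's booked born family must pass, not a discharge.  N14 NOT discharged;
count-neutral.  One finite four-torus programme at fixed ε; NOT ℝ⁴, NOT OS, NOT a mass gap, NOT Clay.  0 sorry.
-/

noncomputable section

namespace YMDAG.N14.BornTermAnnealed

open MeasureTheory ProbabilityTheory Finset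
open scoped ENNReal
open YMDAG.N14.VarianceSocket (condExp_log_gap_le integral_sq_condExp_sub_condExp_of_le energy_identity_antitone)

variable {Ω : Type*} {mΩ : MeasurableSpace Ω} {μ : Measure Ω} [IsFiniteMeasure μ]

/-! ## §1 Plumbing: conditional expectations of `[a, b]`-valued variables; the log gap under an a.e. hypothesis -/

/-- A measurable variable with values in `[a, b]` is integrable (finite measure). [folklore] -/
theorem integrable_of_mem_Icc {N : Ω → ℝ} {a b : ℝ} (hNm : Measurable N) (hN : ∀ᵐ ω ∂μ, N ω ∈ Set.Icc a b) : Integrable N μ :=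
  (memLp_top_of_bound (μ := μ) hNm.aestronglyMeasurable (max |a| |b|) (by
    filter_upwards [hN] with ω hω
    rw [Real.norm_eq_abs]
    exact abs_le_max_abs_abs hω.1 hω.2)).integrable le_top

/-- **VALUES IN `[a, b]` ⇒ CONDITIONAL EXPECTATION IN `[a, b]` A.E.** [folklore] (Mathlib `Convex.condExp_mem` for the closed convex interval). -/
theorem ae_mem_Icc_condExp {m : MeasurableSpace Ω} (hm : m ≤ mΩ) {N : Ω → ℝ} {a b : ℝ} (hNm : Measurable[mΩ] N)
    (hN : ∀ᵐ ω ∂μ, N ω ∈ Set.Icc a b) : ∀ᵐ ω ∂μ, (μ[N|m]) ω ∈ Set.Icc a b :=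
  (convex_Icc a b).condExp_mem hm (integrable_of_mem_Icc hNm hN) isClosed_Icc hN

/-- The log of a variable with values a.e. in `[a, b]`, `0 < a`, is integrable. [folklore] -/
theorem integrable_log_of_mem_Icc {N : Ω → ℝ} {a b : ℝ} (ha : 0 < a) (hNm : Measurable N) (hN : ∀ᵐ ω ∂μ, N ω ∈ Set.Icc a b) :
    Integrable (fun ω => Real.log (N ω)) μ :=
  (memLp_top_of_bound (μ := μ) hNm.log.aestronglyMeasurable (max |Real.log a| |Real.log b|) (by
    filter_upwards [hN] with ω hω
    rw [Real.norm_eq_abs]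
    exact abs_le_max_abs_abs (Real.log_le_log ha hω.1) (Real.log_le_log (ha.trans_le hω.1) hω.2))).integrable le_top

/-- **THE LOG JENSEN GAP UNDER AN A.E. HYPOTHESIS** [folklore]: `…VarianceSocket.condExp_log_gap_le` with `N ∈ [a, b]` only a.e. (clamp `N`
to `[a, max a b]`, which changes nothing a.e.). -/
theorem condExp_log_gap_le_ae {m : MeasurableSpace Ω} (hm : m ≤ mΩ) {N : Ω → ℝ} {a b : ℝ} (ha : 0 < a) (hNm : Measurable[mΩ] N)
    (hN : ∀ᵐ ω ∂μ, N ω ∈ Set.Icc a b) :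
    ∀ᵐ ω ∂μ, Real.log ((μ[N|m]) ω) - (μ[fun ω => Real.log (N ω)|m]) ω
      ≤ (μ[fun ω => (N ω - (μ[N|m]) ω) ^ 2|m]) ω / (2 * a ^ 2) := by
  set N' : Ω → ℝ := fun ω => max a (min b (N ω)) with hN'
  have hN'm : Measurable[mΩ] N' := measurable_const.max (measurable_const.min hNm)
  have hN'mem : ∀ ω, N' ω ∈ Set.Icc a (max a b) := fun ω =>
    ⟨le_max_left _ _, max_le_max le_rfl (min_le_left _ _)⟩
  have hae : N' =ᵐ[μ] N := by
    filter_upwards [hN] with ω hω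
    simp only [hN']
    rw [min_eq_right hω.2, max_eq_right hω.1]
  have key := condExp_log_gap_le (μ := μ) hm ha hN'm hN'mem
  have h1 : μ[N'|m] =ᵐ[μ] μ[N|m] := condExp_congr_ae hae
  have h2 : μ[fun ω => Real.log (N' ω)|m] =ᵐ[μ] μ[fun ω => Real.log (N ω)|m] :=
    condExp_congr_ae (by filter_upwards [hae] with ω hω; rw [hω])
  have h3 : μ[fun ω => (N' ω - (μ[N'|m]) ω) ^ 2|m] =ᵐ[μ] μ[fun ω => (N ω - (μ[N|m]) ω) ^ 2|m] :=
    condExp_congr_ae (by filter_upwards [hae, h1] with ω hω hω'; rw [hω, hω'])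
  filter_upwards [key, h1, h2, h3] with ω hk e1 e2 e3
  rw [← e1, ← e2, ← e3]
  exact hk

/-! ## §2 One step of the chain: the annealed born term is nonnegative and at most the step's energy ∕ (2a²) -/

section Chain

variable (𝒢 : ℕ → MeasurableSpace Ω) (h𝒢 : Antitone 𝒢) (hle : ∀ k, 𝒢 k ≤ mΩ) {Φ : Ω → ℝ} {a b : ℝ} (ha : 0 < a)
  (hΦm : Measurable Φ) (hΦ : ∀ ω, Φ ω ∈ Set.Icc a b)

include hle hΦm hΦ in
/-- Each `μ[Φ|𝒢 k]` is `mΩ`-measurable and a.e. in `[a, b]`. [folklore] -/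
theorem measurable_condExp_and_ae_mem (k : ℕ) :
    Measurable[mΩ] (μ[Φ|𝒢 k]) ∧ ∀ᵐ ω ∂μ, (μ[Φ|𝒢 k]) ω ∈ Set.Icc a b :=
  ⟨(stronglyMeasurable_condExp (m := 𝒢 k) (μ := μ) (f := Φ)).measurable.mono (hle k) le_rfl,
    ae_mem_Icc_condExp (hle k) hΦm (ae_of_all _ hΦ)⟩

include h𝒢 hle ha hΦm hΦ in
/-- **MONOTONICITY OF THE ANNEALED LOG** (card 2: the born terms are nonnegative on average) [folklore]:
`∫ log μ[Φ|𝒢 k] dμ ≤ ∫ log μ[Φ|𝒢 (k+1)] dμ` — conditional Jensen for the concave `log` on `[a, b]` (Mathlib `ConcaveOn.condExp_map_le`)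
and the tower property. -/
theorem integral_log_condExp_le_succ (k : ℕ) :
    ∫ ω, Real.log ((μ[Φ|𝒢 k]) ω) ∂μ ≤ ∫ ω, Real.log ((μ[Φ|𝒢 (k + 1)]) ω) ∂μ := by
  obtain ⟨hNm, hNmem⟩ := measurable_condExp_and_ae_mem (μ := μ) 𝒢 hle hΦm hΦ k
  have hm : 𝒢 (k + 1) ≤ mΩ := hle (k + 1)
  have htower : μ[μ[Φ|𝒢 k]|𝒢 (k + 1)] =ᵐ[μ] μ[Φ|𝒢 (k + 1)] := condExp_condExp_of_le (h𝒢 (Nat.le_succ k)) (hle k)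
  have hconc : ConcaveOn ℝ (Set.Icc a b) Real.log :=
    strictConcaveOn_log_Ioi.concaveOn.subset (fun x hx => ha.trans_le hx.1) (convex_Icc a b)
  have hcont : ContinuousOn Real.log (Set.Icc a b) :=
    Real.continuousOn_log.mono fun x hx => (ha.trans_le hx.1).ne'
  have hJ := hconc.condExp_map_le (μ := μ) (f := μ[Φ|𝒢 k]) hm hcont.upperSemicontinuousOn hNmem isClosed_Icc
    (integrable_of_mem_Icc hNm hNmem) (integrable_log_of_mem_Icc ha hNm hNmem)
  calc ∫ ω, Real.log ((μ[Φ|𝒢 k]) ω) ∂μ = ∫ ω, (μ[Real.log ∘ μ[Φ|𝒢 k]|𝒢 (k + 1)]) ω ∂μ := (integral_condExp hm).symm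
    _ ≤ ∫ ω, Real.log ((μ[Φ|𝒢 (k + 1)]) ω) ∂μ := by
        refine integral_mono_ae integrable_condExp ?_ ?_
        · obtain ⟨hNm', hNmem'⟩ := measurable_condExp_and_ae_mem (μ := μ) 𝒢 hle hΦm hΦ (k + 1)
          exact integrable_log_of_mem_Icc ha hNm' hNmem'
        · filter_upwards [hJ, htower] with ω hω hω'
          rw [← hω']
          exact hω

include h𝒢 hle ha hΦm hΦ in
/-- **ONE STEP: THE ANNEALED BORN TERM IS AT MOST THE STEP'S ENERGY ∕ (2a²)** [folklore]:
`∫ log μ[Φ|𝒢 (k+1)] dμ − ∫ log μ[Φ|𝒢 k] dμ ≤ (∫ (μ[Φ|𝒢 k])² dμ − ∫ (μ[Φ|𝒢 (k+1)])² dμ) ∕ (2a²)` — the pathwise log Jensen gap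
(`…VarianceSocket.condExp_log_gap_le`) integrated, the tower property, and Pythagoras for the orthogonal increment. -/
theorem integral_log_condExp_succ_sub_le (k : ℕ) :
    (∫ ω, Real.log ((μ[Φ|𝒢 (k + 1)]) ω) ∂μ) - ∫ ω, Real.log ((μ[Φ|𝒢 k]) ω) ∂μ
      ≤ ((∫ ω, (μ[Φ|𝒢 k]) ω ^ 2 ∂μ) - ∫ ω, (μ[Φ|𝒢 (k + 1)]) ω ^ 2 ∂μ) / (2 * a ^ 2) := by
  obtain ⟨hNm, hNmem⟩ := measurable_condExp_and_ae_mem (μ := μ) 𝒢 hle hΦm hΦ k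
  obtain ⟨hNm', hNmem'⟩ := measurable_condExp_and_ae_mem (μ := μ) 𝒢 hle hΦm hΦ (k + 1)
  have hm : 𝒢 (k + 1) ≤ mΩ := hle (k + 1)
  have htower : μ[μ[Φ|𝒢 k]|𝒢 (k + 1)] =ᵐ[μ] μ[Φ|𝒢 (k + 1)] := condExp_condExp_of_le (h𝒢 (Nat.le_succ k)) (hle k)
  have hgap := condExp_log_gap_le_ae (μ := μ) hm ha hNm hNmem
  have hΦ2 : MemLp Φ 2 μ :=
    (memLp_top_of_bound (μ := μ) hΦm.aestronglyMeasurable (max |a| |b|) (ae_of_all _ fun ω => by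
      rw [Real.norm_eq_abs]; exact abs_le_max_abs_abs (hΦ ω).1 (hΦ ω).2)).mono_exponent le_top
  have hpyth := integral_sq_condExp_sub_condExp_of_le (μ := μ) (h𝒢 (Nat.le_succ k)) (hle k) hΦ2
  -- integrate the a.e. inequality `log N_{k+1} ≤ μ[log N_k | 𝒢 (k+1)] + μ[(N_k − N_{k+1})² | 𝒢 (k+1)] / (2a²)`
  have hlogk := integrable_log_of_mem_Icc (μ := μ) ha hNm hNmem
  have hlogk' := integrable_log_of_mem_Icc (μ := μ) ha hNm' hNmem'
  have hsqi : Integrable (fun ω => ((μ[Φ|𝒢 k]) ω - (μ[Φ|𝒢 (k + 1)]) ω) ^ 2) μ :=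
    ((hΦ2.condExp one_le_two).sub (hΦ2.condExp one_le_two)).integrable_sq
  have hce : Integrable (μ[fun ω => ((μ[Φ|𝒢 k]) ω - (μ[μ[Φ|𝒢 k]|𝒢 (k + 1)]) ω) ^ 2|𝒢 (k + 1)]) μ := integrable_condExp
  have hcl : Integrable (μ[fun ω => Real.log ((μ[Φ|𝒢 k]) ω)|𝒢 (k + 1)]) μ := integrable_condExp
  have hstep : ∫ ω, Real.log ((μ[Φ|𝒢 (k + 1)]) ω) ∂μ
      ≤ ∫ ω, ((μ[fun ω => Real.log ((μ[Φ|𝒢 k]) ω)|𝒢 (k + 1)]) ω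
          + (μ[fun ω => ((μ[Φ|𝒢 k]) ω - (μ[μ[Φ|𝒢 k]|𝒢 (k + 1)]) ω) ^ 2|𝒢 (k + 1)]) ω / (2 * a ^ 2)) ∂μ := by
    refine integral_mono_ae hlogk' (hcl.add (hce.div_const _)) ?_
    filter_upwards [hgap, htower] with ω hω hω'
    rw [hω'] at hω
    linarith
  rw [integral_add hcl (hce.div_const _), integral_div, integral_condExp hm, integral_condExp hm] at hstep
  -- the integrated conditional variance is the energy of the increment
  have hvar : ∫ ω, ((μ[Φ|𝒢 k]) ω - (μ[μ[Φ|𝒢 k]|𝒢 (k + 1)]) ω) ^ 2 ∂μ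
      = (∫ ω, (μ[Φ|𝒢 k]) ω ^ 2 ∂μ) - ∫ ω, (μ[Φ|𝒢 (k + 1)]) ω ^ 2 ∂μ := by
    rw [← hpyth]
    exact integral_congr_ae (by filter_upwards [htower] with ω hω; rw [hω])
  rw [hvar] at hstep
  linarith

/-! ## §3 Telescoped: the annealed total of the born terms lies between `0` and the initial energy ∕ (2a²), uniformly in `K` -/

include h𝒢 hle ha hΦm hΦ in
/-- **THE ANNEALED TOTAL DRESSING IS BETWEEN `0` AND THE INITIAL ENERGY ∕ (2a²), UNIFORMLY IN THE NUMBER OF STEPS** (LENS control, card 2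
(iii)) [folklore].  For `Φ ∈ [a, b]` measurable, `0 < a`, `μ` finite, `𝒢` antitone:
`0 ≤ ∫ log μ[Φ|𝒢 K] − ∫ log μ[Φ|𝒢 0] ≤ (∫ (μ[Φ|𝒢 0])² − ∫ (μ[Φ|𝒢 K])²) ∕ (2a²)`.  In dressed-tower words (card 2): the sum over the
steps of the annealed born terms `E[log N (k+1) − log N k]` is nonnegative and at most `(E N₀² − E N_K²)∕(2a²) ≤ Var-type∕(2a²)` — no rate,
no locality, no estimate of Bałaban's. -/
theorem integral_log_condExp_sub_mem (K : ℕ) :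
    0 ≤ (∫ ω, Real.log ((μ[Φ|𝒢 K]) ω) ∂μ) - ∫ ω, Real.log ((μ[Φ|𝒢 0]) ω) ∂μ ∧
    (∫ ω, Real.log ((μ[Φ|𝒢 K]) ω) ∂μ) - ∫ ω, Real.log ((μ[Φ|𝒢 0]) ω) ∂μ
      ≤ ((∫ ω, (μ[Φ|𝒢 0]) ω ^ 2 ∂μ) - ∫ ω, (μ[Φ|𝒢 K]) ω ^ 2 ∂μ) / (2 * a ^ 2) := by
  set L : ℕ → ℝ := fun k => ∫ ω, Real.log ((μ[Φ|𝒢 k]) ω) ∂μ with hL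
  set E : ℕ → ℝ := fun k => ∫ ω, (μ[Φ|𝒢 k]) ω ^ 2 ∂μ with hE
  have hmono : ∀ k, L k ≤ L (k + 1) := fun k => integral_log_condExp_le_succ (μ := μ) 𝒢 h𝒢 hle ha hΦm hΦ k
  have hstep : ∀ k, L (k + 1) - L k ≤ (E k - E (k + 1)) / (2 * a ^ 2) := fun k =>
    integral_log_condExp_succ_sub_le (μ := μ) 𝒢 h𝒢 hle ha hΦm hΦ k
  have htel : ∀ K, L K - L 0 = ∑ k ∈ range K, (L (k + 1) - L k) := fun K => (sum_range_sub L K).symm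
  have htelE : ∀ K, E 0 - E K = ∑ k ∈ range K, (E k - E (k + 1)) := fun K => (sum_range_sub' E K).symm
  refine ⟨?_, ?_⟩
  · show 0 ≤ L K - L 0
    rw [htel]
    exact sum_nonneg fun k _ => sub_nonneg.mpr (hmono k)
  · show L K - L 0 ≤ (E 0 - E K) / (2 * a ^ 2)
    rw [htel, htelE, sum_div]
    exact sum_le_sum fun k _ => hstep k

include h𝒢 hle ha hΦm hΦ in
/-- … in particular `∫ log μ[Φ|𝒢 K] − ∫ log μ[Φ|𝒢 0] ≤ ∫ (μ[Φ|𝒢 0])² ∕ (2a²)` for every `K`. [folklore] -/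
theorem integral_log_condExp_sub_le (K : ℕ) :
    (∫ ω, Real.log ((μ[Φ|𝒢 K]) ω) ∂μ) - ∫ ω, Real.log ((μ[Φ|𝒢 0]) ω) ∂μ
      ≤ (∫ ω, (μ[Φ|𝒢 0]) ω ^ 2 ∂μ) / (2 * a ^ 2) := by
  have h := (integral_log_condExp_sub_mem (μ := μ) 𝒢 h𝒢 hle ha hΦm hΦ K).2
  have hE : 0 ≤ ∫ ω, (μ[Φ|𝒢 K]) ω ^ 2 ∂μ := integral_nonneg fun ω => sq_nonneg _
  have ha2 : 0 < 2 * a ^ 2 := by positivity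
  exact h.trans (div_le_div_of_nonneg_right (by linarith) ha2.le)

end Chain

end YMDAG.N14.BornTermAnnealed

end
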